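import Mathlib
import Literature.NumberTheory.LFunctions.Zhang2022.TypedSection15B
import HarnessLib

/-!
# Zhang (2022) §15 (15.16): the residues `ℛ_{1j}` of the function (15.16) at `s = −β_j`, identified

Topic `Literature/NumberTheory/LFunctions/Zhang2022` (Landau–Siegel audit tree; verdict-neutral).
Y. Zhang, *Discrete mean estimates and the Landau–Siegel zero*, arXiv:2211.02515v1 (2022)
[Zhang2022LandauSiegel] — **an unrefereed manuscript under adjudication**; nothing here is a claim
of the manuscript. (15.16) [Z22 p.85, tex L4221–4224]: "`ℛ_{1j}` denotes the residue of the function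
`ζ(1+s+β₁)ζ(1+s+β₂)ζ(1+s)⁻¹L(1+s,χ)⁻¹·P₄^{s+β₃}ω₁(s+β₃)/(s+β₃)` at `s = −β_j`". The tree types
`ℛ_{1j}` as `Typed.Section15B.calR1 c′ χ j := limUnder (𝓝[≠] (−β_j)) ((s+β_j)·F1516 c′ χ s)`. This file
COMPUTES the three limits (the poles are simple: at `−β₁`, `−β₂` from `ζ(1+s+β₁)ζ(1+s+β₂)`, at `−β₃`
from `(s+β₃)⁻¹`), under the non-degeneracy hypotheses the consumer discharges for large `D` (the `β_j`
distinct and non-zero, `ζ(1−β_j) ≠ 0`, `L(1−β_j,χ) ≠ 0`):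
`ℛ₁₁ = ζ(1−β₁+β₂)ζ(1−β₁)⁻¹L(1−β₁,χ)⁻¹·P₄^{β₃−β₁}ω₁(β₃−β₁)/(β₃−β₁)` (`calR1_one_eq`), the symmetric
`ℛ₁₂` (`calR1_two_eq`), and `ℛ₁₃ = ζ(1−β₃+β₁)ζ(1−β₃+β₂)ζ(1−β₃)⁻¹L(1−β₃,χ)⁻¹` (`calR1_three_eq`), via
Mathlib's entire `ζ₁(w) = (w−1)ζ(w)` (`riemannZeta₁`, `ζ₁(1) = 1`).
[cite: Zhang2022LandauSiegel, §15 (15.16) p.85]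

## References
* Y. Zhang, arXiv:2211.02515v1 (2022), §15 (15.16) p.85. [cite: Zhang2022LandauSiegel, §15 (15.16)]
-/

noncomputable section

open Complex Real Set Filter Topology
open Literature.NumberTheory.LFunctions.Zhang2022.Skeleton

namespace Literature.NumberTheory.LFunctions.Zhang2022.Typed.Section15B

variable (c' : ℝ) {D : ℕ} [NeZero D] (χ : DirichletCharacter ℂ D)

/-! ### Continuity helpers -/

omit [NeZero D] in
/-- `s ↦ P₄^{s+β₃}` is continuous (`P₄ > 0`). [folklore] -/
private theorem continuous_P4_cpow (hP : 0 < P4 D) (γ : ℂ) :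
    Continuous fun s : ℂ => (P4 D : ℂ) ^ (s + γ) := by
  have hP0 : (P4 D : ℂ) ≠ 0 := by exact_mod_cast hP.ne'
  exact (continuous_iff_continuousAt.mpr fun b => continuousAt_const_cpow hP0).comp (by fun_prop)

omit [NeZero D] in
/-- `s ↦ ω₁(s + γ)` is continuous. [folklore] -/
private theorem continuous_omega1_shift (Λ : ℝ) (γ : ℂ) :
    Continuous fun s : ℂ => GaussWeight.omega1 Λ (s + γ) := by
  unfold GaussWeight.omega1; fun_prop

/-- `s ↦ ζ(1+s+γ)` is continuous at `s₀` when `1+s₀+γ ≠ 1`. [folklore] -/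
private theorem continuousAt_zeta_shift {γ s₀ : ℂ} (h : (1 : ℂ) + s₀ + γ ≠ 1) :
    ContinuousAt (fun s : ℂ => riemannZeta (1 + s + γ)) s₀ := by
  have h2 : ContinuousAt (fun s : ℂ => 1 + s + γ) s₀ := by fun_prop
  exact ContinuousAt.comp (f := fun s : ℂ => 1 + s + γ) (differentiableAt_riemannZeta h).continuousAt h2

/-! ### `ℛ₁₁` and `ℛ₁₂`: the poles of `ζ(1+s+β₁)ζ(1+s+β₂)` -/

/-- The regular factor at `−β₁`: `g₁(s) = ζ₁(1+s+β₁)·ζ(1+s+β₂)ζ(1+s)⁻¹L(1+s,χ)⁻¹·P₄^{s+β₃}ω₁(s+β₃)(s+β₃)⁻¹`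
agrees with `(s+β₁)·F1516(s)` off `s = −β₁`. [cite: Zhang2022LandauSiegel, §15 (15.16) p.85] -/
theorem mul_F1516_eq_of_ne {s : ℂ} (hs : s ≠ -beta1 c' D) :
    (s + beta1 c' D) * F1516 c' χ s =
      riemannZeta₁ (1 + s + beta1 c' D) * (riemannZeta (1 + s + beta2 c' D) /
        (riemannZeta (1 + s) * χ.LFunction (1 + s)) *
        ((P4 D : ℂ) ^ (s + beta3 c' D) * GaussWeight.omega1 (ell D ^ 30) (s + beta3 c' D) /
          (s + beta3 c' D))) := by
  have h1 : (1 : ℂ) + s + beta1 c' D ≠ 1 := by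
    intro h; apply hs; linear_combination h
  rw [F1516, riemannZeta_eq_inv_sub_mul h1, show (1 : ℂ) + s + beta1 c' D - 1 = s + beta1 c' D by ring]
  have hs' : s + beta1 c' D ≠ 0 := by intro h; apply hs; linear_combination h
  field_simp

/-- **The limit defining `ℛ₁₁`.** If `β₁ ≠ 0`, `β₁ ≠ β₂`, `β₁ ≠ β₃`, `ζ(1−β₁) ≠ 0`, `L(1−β₁,χ) ≠ 0`, then
`(s+β₁)F1516(s) → ζ(1−β₁+β₂)ζ(1−β₁)⁻¹L(1−β₁,χ)⁻¹·P₄^{β₃−β₁}ω₁(β₃−β₁)/(β₃−β₁)` as `s → −β₁`, `s ≠ −β₁`.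
[cite: Zhang2022LandauSiegel, §15 (15.16) p.85] -/
theorem tendsto_residue_one (hχ1 : χ ≠ 1) (hP : 0 < P4 D) (h10 : beta1 c' D ≠ 0)
    (h12 : beta1 c' D ≠ beta2 c' D) (h13 : beta1 c' D ≠ beta3 c' D)
    (hζ : riemannZeta (1 - beta1 c' D) ≠ 0) (hL : χ.LFunction (1 - beta1 c' D) ≠ 0) :
    Tendsto (fun s => (s + beta1 c' D) * F1516 c' χ s) (𝓝[≠] (-beta1 c' D))
      (𝓝 (riemannZeta (1 - beta1 c' D + beta2 c' D) /
        (riemannZeta (1 - beta1 c' D) * χ.LFunction (1 - beta1 c' D)) *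
        ((P4 D : ℂ) ^ (beta3 c' D - beta1 c' D) *
          GaussWeight.omega1 (ell D ^ 30) (beta3 c' D - beta1 c' D) / (beta3 c' D - beta1 c' D)))) := by
  set b₁ := beta1 c' D
  set b₂ := beta2 c' D
  set b₃ := beta3 c' D
  -- the regular factor `g`
  set g : ℂ → ℂ := fun s => riemannZeta₁ (1 + s + b₁) * (riemannZeta (1 + s + b₂) /
      (riemannZeta (1 + s) * χ.LFunction (1 + s)) *
      ((P4 D : ℂ) ^ (s + b₃) * GaussWeight.omega1 (ell D ^ 30) (s + b₃) / (s + b₃))) with hg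
  have hcont : ContinuousAt g (-b₁) := by
    have h1 : ContinuousAt (fun s : ℂ => riemannZeta₁ (1 + s + b₁)) (-b₁) :=
      (differentiable_riemannZeta₁.continuous.comp (by fun_prop)).continuousAt
    have h2 : ContinuousAt (fun s : ℂ => riemannZeta (1 + s + b₂)) (-b₁) :=
      continuousAt_zeta_shift (by intro h; apply h12; linear_combination -h)
    have h3 : ContinuousAt (fun s : ℂ => riemannZeta (1 + s)) (-b₁) := by
      have : (1 : ℂ) + -b₁ ≠ 1 := by intro h; apply h10; linear_combination -h
      exact ((differentiableAt_riemannZeta this).continuousAt).comp (by fun_prop)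
    have h4 : ContinuousAt (fun s : ℂ => χ.LFunction (1 + s)) (-b₁) :=
      ((DirichletCharacter.differentiable_LFunction hχ1).continuous.comp (by fun_prop)).continuousAt
    have h5 : ContinuousAt (fun s : ℂ => (P4 D : ℂ) ^ (s + b₃)) (-b₁) :=
      (continuous_P4_cpow hP b₃).continuousAt
    have h6 : ContinuousAt (fun s : ℂ => GaussWeight.omega1 (ell D ^ 30) (s + b₃)) (-b₁) :=
      (continuous_omega1_shift (ell D ^ 30) b₃).continuousAt
    have h7 : ContinuousAt (fun s : ℂ => s + b₃) (-b₁) := by fun_prop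
    have hne3 : riemannZeta (1 + -b₁) * χ.LFunction (1 + -b₁) ≠ 0 := by
      rw [← sub_eq_add_neg]; exact mul_ne_zero hζ hL
    have hne7 : (-b₁ : ℂ) + b₃ ≠ 0 := by intro h; apply h13; linear_combination -h
    exact h1.mul (((h2.div (h3.mul h4) hne3)).mul ((h5.mul h6).div h7 hne7))
  have hval : g (-b₁) = riemannZeta (1 - b₁ + b₂) / (riemannZeta (1 - b₁) * χ.LFunction (1 - b₁)) *
      ((P4 D : ℂ) ^ (b₃ - b₁) * GaussWeight.omega1 (ell D ^ 30) (b₃ - b₁) / (b₃ - b₁)) := by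
    simp only [hg]
    rw [show (1 : ℂ) + -b₁ + b₁ = 1 by ring, riemannZeta₁_one, one_mul,
      show (1 : ℂ) + -b₁ + b₂ = 1 - b₁ + b₂ by ring, show (1 : ℂ) + -b₁ = 1 - b₁ by ring,
      show (-b₁ : ℂ) + b₃ = b₃ - b₁ by ring]
  rw [← hval]
  refine (hcont.tendsto.mono_left nhdsWithin_le_nhds).congr' ?_
  filter_upwards [self_mem_nhdsWithin] with s hs
  exact (mul_F1516_eq_of_ne c' χ hs).symm

/-- **`ℛ₁₁` evaluated** (`betaJ 1 = β₁`): under the hypotheses of `tendsto_residue_one`,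
`calR1 c′ χ 1 = ζ(1−β₁+β₂)ζ(1−β₁)⁻¹L(1−β₁,χ)⁻¹·P₄^{β₃−β₁}ω₁(β₃−β₁)/(β₃−β₁)`.
[cite: Zhang2022LandauSiegel, §15 (15.16) p.85] -/
theorem calR1_one_eq (hχ1 : χ ≠ 1) (hP : 0 < P4 D) (h10 : beta1 c' D ≠ 0)
    (h12 : beta1 c' D ≠ beta2 c' D) (h13 : beta1 c' D ≠ beta3 c' D)
    (hζ : riemannZeta (1 - beta1 c' D) ≠ 0) (hL : χ.LFunction (1 - beta1 c' D) ≠ 0) :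
    calR1 c' χ 1 = riemannZeta (1 - beta1 c' D + beta2 c' D) /
        (riemannZeta (1 - beta1 c' D) * χ.LFunction (1 - beta1 c' D)) *
        ((P4 D : ℂ) ^ (beta3 c' D - beta1 c' D) *
          GaussWeight.omega1 (ell D ^ 30) (beta3 c' D - beta1 c' D) / (beta3 c' D - beta1 c' D)) := by
  have hβ : betaJ c' D 1 = beta1 c' D := by simp [betaJ]
  rw [calR1, hβ]
  exact (tendsto_residue_one c' χ hχ1 hP h10 h12 h13 hζ hL).limUnder_eq

/-! The symmetric statement for `ℛ₁₂` (swap `β₁ ↔ β₂`). -/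

/-- `(s+β₂)·F1516(s)` off `s = −β₂`. [cite: Zhang2022LandauSiegel, §15 (15.16) p.85] -/
theorem mul_F1516_eq_of_ne_two {s : ℂ} (hs : s ≠ -beta2 c' D) :
    (s + beta2 c' D) * F1516 c' χ s =
      riemannZeta₁ (1 + s + beta2 c' D) * (riemannZeta (1 + s + beta1 c' D) /
        (riemannZeta (1 + s) * χ.LFunction (1 + s)) *
        ((P4 D : ℂ) ^ (s + beta3 c' D) * GaussWeight.omega1 (ell D ^ 30) (s + beta3 c' D) /
          (s + beta3 c' D))) := by
  have h1 : (1 : ℂ) + s + beta2 c' D ≠ 1 := by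
    intro h; apply hs; linear_combination h
  rw [F1516, riemannZeta_eq_inv_sub_mul h1, show (1 : ℂ) + s + beta2 c' D - 1 = s + beta2 c' D by ring]
  have hs' : s + beta2 c' D ≠ 0 := by intro h; apply hs; linear_combination h
  field_simp

/-- **The limit defining `ℛ₁₂`** (symmetric to `tendsto_residue_one`).
[cite: Zhang2022LandauSiegel, §15 (15.16) p.85] -/
theorem tendsto_residue_two (hχ1 : χ ≠ 1) (hP : 0 < P4 D) (h20 : beta2 c' D ≠ 0)
    (h21 : beta2 c' D ≠ beta1 c' D) (h23 : beta2 c' D ≠ beta3 c' D)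
    (hζ : riemannZeta (1 - beta2 c' D) ≠ 0) (hL : χ.LFunction (1 - beta2 c' D) ≠ 0) :
    Tendsto (fun s => (s + beta2 c' D) * F1516 c' χ s) (𝓝[≠] (-beta2 c' D))
      (𝓝 (riemannZeta (1 - beta2 c' D + beta1 c' D) /
        (riemannZeta (1 - beta2 c' D) * χ.LFunction (1 - beta2 c' D)) *
        ((P4 D : ℂ) ^ (beta3 c' D - beta2 c' D) *
          GaussWeight.omega1 (ell D ^ 30) (beta3 c' D - beta2 c' D) / (beta3 c' D - beta2 c' D)))) := by
  set b₁ := beta1 c' D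
  set b₂ := beta2 c' D
  set b₃ := beta3 c' D
  set g : ℂ → ℂ := fun s => riemannZeta₁ (1 + s + b₂) * (riemannZeta (1 + s + b₁) /
      (riemannZeta (1 + s) * χ.LFunction (1 + s)) *
      ((P4 D : ℂ) ^ (s + b₃) * GaussWeight.omega1 (ell D ^ 30) (s + b₃) / (s + b₃))) with hg
  have hcont : ContinuousAt g (-b₂) := by
    have h1 : ContinuousAt (fun s : ℂ => riemannZeta₁ (1 + s + b₂)) (-b₂) :=
      (differentiable_riemannZeta₁.continuous.comp (by fun_prop)).continuousAt
    have h2 : ContinuousAt (fun s : ℂ => riemannZeta (1 + s + b₁)) (-b₂) :=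
      continuousAt_zeta_shift (by intro h; apply h21; linear_combination -h)
    have h3 : ContinuousAt (fun s : ℂ => riemannZeta (1 + s)) (-b₂) := by
      have : (1 : ℂ) + -b₂ ≠ 1 := by intro h; apply h20; linear_combination -h
      exact ((differentiableAt_riemannZeta this).continuousAt).comp (by fun_prop)
    have h4 : ContinuousAt (fun s : ℂ => χ.LFunction (1 + s)) (-b₂) :=
      ((DirichletCharacter.differentiable_LFunction hχ1).continuous.comp (by fun_prop)).continuousAt
    have h5 : ContinuousAt (fun s : ℂ => (P4 D : ℂ) ^ (s + b₃)) (-b₂) :=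
      (continuous_P4_cpow hP b₃).continuousAt
    have h6 : ContinuousAt (fun s : ℂ => GaussWeight.omega1 (ell D ^ 30) (s + b₃)) (-b₂) :=
      (continuous_omega1_shift (ell D ^ 30) b₃).continuousAt
    have h7 : ContinuousAt (fun s : ℂ => s + b₃) (-b₂) := by fun_prop
    have hne3 : riemannZeta (1 + -b₂) * χ.LFunction (1 + -b₂) ≠ 0 := by
      rw [← sub_eq_add_neg]; exact mul_ne_zero hζ hL
    have hne7 : (-b₂ : ℂ) + b₃ ≠ 0 := by intro h; apply h23; linear_combination -h
    exact h1.mul (((h2.div (h3.mul h4) hne3)).mul ((h5.mul h6).div h7 hne7))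
  have hval : g (-b₂) = riemannZeta (1 - b₂ + b₁) / (riemannZeta (1 - b₂) * χ.LFunction (1 - b₂)) *
      ((P4 D : ℂ) ^ (b₃ - b₂) * GaussWeight.omega1 (ell D ^ 30) (b₃ - b₂) / (b₃ - b₂)) := by
    simp only [hg]
    rw [show (1 : ℂ) + -b₂ + b₂ = 1 by ring, riemannZeta₁_one, one_mul,
      show (1 : ℂ) + -b₂ + b₁ = 1 - b₂ + b₁ by ring, show (1 : ℂ) + -b₂ = 1 - b₂ by ring,
      show (-b₂ : ℂ) + b₃ = b₃ - b₂ by ring]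
  rw [← hval]
  refine (hcont.tendsto.mono_left nhdsWithin_le_nhds).congr' ?_
  filter_upwards [self_mem_nhdsWithin] with s hs
  exact (mul_F1516_eq_of_ne_two c' χ hs).symm

/-- **`ℛ₁₂` evaluated** (`betaJ 2 = β₂`). [cite: Zhang2022LandauSiegel, §15 (15.16) p.85] -/
theorem calR1_two_eq (hχ1 : χ ≠ 1) (hP : 0 < P4 D) (h20 : beta2 c' D ≠ 0)
    (h21 : beta2 c' D ≠ beta1 c' D) (h23 : beta2 c' D ≠ beta3 c' D)
    (hζ : riemannZeta (1 - beta2 c' D) ≠ 0) (hL : χ.LFunction (1 - beta2 c' D) ≠ 0) :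
    calR1 c' χ 2 = riemannZeta (1 - beta2 c' D + beta1 c' D) /
        (riemannZeta (1 - beta2 c' D) * χ.LFunction (1 - beta2 c' D)) *
        ((P4 D : ℂ) ^ (beta3 c' D - beta2 c' D) *
          GaussWeight.omega1 (ell D ^ 30) (beta3 c' D - beta2 c' D) / (beta3 c' D - beta2 c' D)) := by
  have hβ : betaJ c' D 2 = beta2 c' D := by simp [betaJ]
  rw [calR1, hβ]
  exact (tendsto_residue_two c' χ hχ1 hP h20 h21 h23 hζ hL).limUnder_eq

/-! ### `ℛ₁₃`: the pole of `(s+β₃)⁻¹` -/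

/-- `(s+β₃)·F1516(s)` off `s = −β₃`: the factor `(s+β₃)⁻¹` cancels.
[cite: Zhang2022LandauSiegel, §15 (15.16) p.85] -/
theorem mul_F1516_eq_of_ne_three {s : ℂ} (hs : s ≠ -beta3 c' D) :
    (s + beta3 c' D) * F1516 c' χ s =
      riemannZeta (1 + s + beta1 c' D) * riemannZeta (1 + s + beta2 c' D) /
        (riemannZeta (1 + s) * χ.LFunction (1 + s)) *
        ((P4 D : ℂ) ^ (s + beta3 c' D) * GaussWeight.omega1 (ell D ^ 30) (s + beta3 c' D)) := by
  have hs' : s + beta3 c' D ≠ 0 := by intro h; apply hs; linear_combination h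
  rw [F1516]
  field_simp

/-- **The limit defining `ℛ₁₃`.** If `β₃ ≠ 0`, `β₃ ≠ β₁`, `β₃ ≠ β₂`, `ζ(1−β₃) ≠ 0`, `L(1−β₃,χ) ≠ 0`, then
`(s+β₃)F1516(s) → ζ(1−β₃+β₁)ζ(1−β₃+β₂)ζ(1−β₃)⁻¹L(1−β₃,χ)⁻¹` (`P₄⁰ω₁(0) = 1`).
[cite: Zhang2022LandauSiegel, §15 (15.16) p.85] -/
theorem tendsto_residue_three (hχ1 : χ ≠ 1) (hP : 0 < P4 D) (h30 : beta3 c' D ≠ 0)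
    (h31 : beta3 c' D ≠ beta1 c' D) (h32 : beta3 c' D ≠ beta2 c' D)
    (hζ : riemannZeta (1 - beta3 c' D) ≠ 0) (hL : χ.LFunction (1 - beta3 c' D) ≠ 0) :
    Tendsto (fun s => (s + beta3 c' D) * F1516 c' χ s) (𝓝[≠] (-beta3 c' D))
      (𝓝 (riemannZeta (1 - beta3 c' D + beta1 c' D) * riemannZeta (1 - beta3 c' D + beta2 c' D) /
        (riemannZeta (1 - beta3 c' D) * χ.LFunction (1 - beta3 c' D)))) := by
  set b₁ := beta1 c' D
  set b₂ := beta2 c' D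
  set b₃ := beta3 c' D
  set g : ℂ → ℂ := fun s => riemannZeta (1 + s + b₁) * riemannZeta (1 + s + b₂) /
      (riemannZeta (1 + s) * χ.LFunction (1 + s)) *
      ((P4 D : ℂ) ^ (s + b₃) * GaussWeight.omega1 (ell D ^ 30) (s + b₃)) with hg
  have hcont : ContinuousAt g (-b₃) := by
    have h1 : ContinuousAt (fun s : ℂ => riemannZeta (1 + s + b₁)) (-b₃) :=
      continuousAt_zeta_shift (by intro h; apply h31; linear_combination -h)
    have h2 : ContinuousAt (fun s : ℂ => riemannZeta (1 + s + b₂)) (-b₃) :=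
      continuousAt_zeta_shift (by intro h; apply h32; linear_combination -h)
    have h3 : ContinuousAt (fun s : ℂ => riemannZeta (1 + s)) (-b₃) := by
      have : (1 : ℂ) + -b₃ ≠ 1 := by intro h; apply h30; linear_combination -h
      exact ((differentiableAt_riemannZeta this).continuousAt).comp (by fun_prop)
    have h4 : ContinuousAt (fun s : ℂ => χ.LFunction (1 + s)) (-b₃) :=
      ((DirichletCharacter.differentiable_LFunction hχ1).continuous.comp (by fun_prop)).continuousAt
    have h5 : ContinuousAt (fun s : ℂ => (P4 D : ℂ) ^ (s + b₃)) (-b₃) :=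
      (continuous_P4_cpow hP b₃).continuousAt
    have h6 : ContinuousAt (fun s : ℂ => GaussWeight.omega1 (ell D ^ 30) (s + b₃)) (-b₃) :=
      (continuous_omega1_shift (ell D ^ 30) b₃).continuousAt
    have hne3 : riemannZeta (1 + -b₃) * χ.LFunction (1 + -b₃) ≠ 0 := by
      rw [← sub_eq_add_neg]; exact mul_ne_zero hζ hL
    exact (((h1.mul h2).div (h3.mul h4) hne3)).mul (h5.mul h6)
  have hval : g (-b₃) = riemannZeta (1 - b₃ + b₁) * riemannZeta (1 - b₃ + b₂) /
      (riemannZeta (1 - b₃) * χ.LFunction (1 - b₃)) := by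
    simp only [hg]
    have hP0 : (P4 D : ℂ) ≠ 0 := by exact_mod_cast hP.ne'
    rw [show (-b₃ : ℂ) + b₃ = 0 by ring, Complex.cpow_zero, GaussWeight.omega1]
    simp [sub_eq_add_neg]
  rw [← hval]
  refine (hcont.tendsto.mono_left nhdsWithin_le_nhds).congr' ?_
  filter_upwards [self_mem_nhdsWithin] with s hs
  exact (mul_F1516_eq_of_ne_three c' χ hs).symm

/-- **`ℛ₁₃` evaluated** (`betaJ 3 = β₃`). [cite: Zhang2022LandauSiegel, §15 (15.16) p.85] -/
theorem calR1_three_eq (hχ1 : χ ≠ 1) (hP : 0 < P4 D) (h30 : beta3 c' D ≠ 0)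
    (h31 : beta3 c' D ≠ beta1 c' D) (h32 : beta3 c' D ≠ beta2 c' D)
    (hζ : riemannZeta (1 - beta3 c' D) ≠ 0) (hL : χ.LFunction (1 - beta3 c' D) ≠ 0) :
    calR1 c' χ 3 = riemannZeta (1 - beta3 c' D + beta1 c' D) * riemannZeta (1 - beta3 c' D + beta2 c' D) /
        (riemannZeta (1 - beta3 c' D) * χ.LFunction (1 - beta3 c' D)) := by
  have hβ : betaJ c' D 3 = beta3 c' D := by simp [betaJ]
  rw [calR1, hβ]
  exact (tendsto_residue_three c' χ hχ1 hP h30 h31 h32 hζ hL).limUnder_eq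

end Literature.NumberTheory.LFunctions.Zhang2022.Typed.Section15B
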